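import Literature.Geometry.Lorentzian.KerrSchildEnergyEstimate
import Summits.FinalStateConjecture.FinalStateConjecture.Theorems.EIHFluxBalanceLLBalanceLawIdentities
import Summits.FinalStateConjecture.FinalStateConjecture.Theorems.EIHFluxBalanceLLBalanceLawSphere

/-!
# Route EIHFluxBalance — `LLBalanceLaw`, clause (iv): the balance law `dP^μ/dt = −Φ^μ`

Helper file for the support item `stmt-FinalStateConjecture-10189`
(`Summit.FinalStateConjecture.FinalStateConjecture.Theses.EIHFluxBalance.LLBalanceLaw`). Its fourth
conjunct is the **Landau–Lifshitz balance law on a coordinate sphere surrounded by vacuum**: for a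
`C^∞` field of bilinear forms `g` with `det (g_{μν}) ≠ 0` and `Ric(g) = 0` on an open `U ⊆ E4`
containing the sphere `{x⁰ = t, |y − ξ| = R}`, the quasi-local four-momentum
`P^μ(s) = ∮_{|y−ξ|=R} Σ_j h^{μ0j}(s, y) n_j dσ(y)` (LL (96.16), `σ = μHE[2]`) satisfies

  `dP^μ/ds |_{s=t} = −Φ^μ(t) = −∮ Σ_j (−g) t^{μj}_LL n_j dσ`

(`hasDerivAt_quasiLocalMomentum`). The proof is LL §96: differentiate under the integral sign
(a slab of nearby slices `{s} × S_R` stays inside `U`, `exists_slab_subset`, on which `∂₀h` is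
bounded); pointwise `∂₀ h^{μ0j} = −Σ_α ∂_α h^{μjα} + Σ_{l} ∂_l h^{μjl}` (`partialDeriv_zero_hField`,
from the antisymmetry (96.4)), where in vacuum `Σ_α ∂_α h^{μjα} = (−g) t^{μj}_LL` ((96.7) with
`G = 0`); and the flux of the spatial curl `Σ_l ∂_l h^{μjl}` through the CLOSED sphere vanishes
(`LLBalance.setIntegral_sphere_sum_fderiv_antisymm_eq_zero_of_contDiffOn` of the sphere file) —
so only the metric near the sphere is used and black holes inside the sphere are allowed.

Sources: Landau–Lifshitz, *The Classical Theory of Fields* §96, (96.4)–(96.16)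
(key `LandauLifshitz1975`); Blanchet, Living Rev. Relativ., arXiv:1310.1528, §2.
-/

noncomputable section

open Set Metric Filter Module
open MeasureTheory MeasureTheory.Measure
open scoped Topology ContDiff

namespace Summit.FinalStateConjecture.FinalStateConjecture.Theorems

namespace LLBalance

open Literature.Geometry.Lorentzian

/-! ### Clause (iv): the balance law `dP^μ/dt = −Φ^μ` on a coordinate sphere in vacuum -/

section Momentum

open Literature.Geometry.Lorentzian.LandauLifshitz

variable {g : E4 → E4 →L[ℝ] E4 →L[ℝ] ℝ} {U : Set E4}

/-- The slice embedding sends the spatial coordinate vector `e_l` of `E3` to `∂_{l+1}`.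
[folklore] -/
theorem spaceEmbed_single (l : Fin 3) :
    E4.spaceEmbed (EuclideanSpace.single l (1 : ℝ)) = E4.basisVector l.succ := by
  ext i
  refine Fin.cases ?_ (fun k ↦ ?_) i
  · simp [E4.basisVector, Fin.succ_ne_zero]
  · simp [E4.basisVector, Fin.succ_inj]

/-- Two points on the same `x⁰`-line are at distance the time difference. [folklore] -/
theorem dist_ofTimeSpace_left (s t : ℝ) (y : E3) :
    dist (E4.ofTimeSpace s y) (E4.ofTimeSpace t y) = dist s t := by
  rw [dist_eq_norm, E4.ofTimeSpace_eq_smul_add' s y, E4.ofTimeSpace_eq_smul_add' t y,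
    add_sub_add_right_eq_sub, ← sub_smul, norm_smul, Real.norm_eq_abs, Real.dist_eq]
  have : ‖E4.basisVector 0‖ = 1 := by simp [E4.basisVector]
  rw [this, mul_one]

/-- **Slab lemma**: if the slice `{t} × K` of a compact `K ⊆ E3` lies in the open set `U ⊆ E4`,
then so do the nearby slices `{s} × K`, `|s − t| < δ`. [folklore] -/
theorem exists_slab_subset (hU : IsOpen U) {t : ℝ} {K : Set E3} (hK : IsCompact K)
    (hKU : ∀ y ∈ K, E4.ofTimeSpace t y ∈ U) :
    ∃ δ > 0, ∀ s, dist s t < δ → ∀ y ∈ K, E4.ofTimeSpace s y ∈ U := by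
  have hc : IsCompact (E4.ofTimeSpace t '' K) := hK.image (E4.continuous_ofTimeSpace t)
  have hsub : E4.ofTimeSpace t '' K ⊆ U := by
    rintro _ ⟨y, hy, rfl⟩
    exact hKU y hy
  obtain ⟨δ, hδ, hthick⟩ := hc.exists_thickening_subset_open hU hsub
  refine ⟨δ, hδ, fun s hs y hy ↦ hthick ?_⟩
  rw [Metric.mem_thickening_iff]
  exact ⟨E4.ofTimeSpace t y, mem_image_of_mem _ hy, by rwa [dist_ofTimeSpace_left]⟩

/-- A function continuous on `U` is continuous along the slice map on `(E4.ofTimeSpace t)⁻¹ U`.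
[folklore] -/
theorem continuousOn_comp_ofTimeSpace {G : E4 → ℝ} (hG : ContinuousOn G U) (t : ℝ) :
    ContinuousOn (fun y ↦ G (E4.ofTimeSpace t y)) (E4.ofTimeSpace t ⁻¹' U) :=
  hG.comp (E4.continuous_ofTimeSpace t).continuousOn (mapsTo_preimage _ _)

/-- The energy–momentum complex `y ↦ Σ_α ∂_α h^{μνα}(y)` is `C^∞` where `det (g_{μν}) ≠ 0`.
[cite: LandauLifshitz1975, §96 (96.5)] -/
theorem contDiffOn_emComplex (hU : IsOpen U) (hg : ContDiffOn ℝ ∞ g U)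
    (hdet : ∀ x ∈ U, metricDet g x ≠ 0) (μ ν : Fin 4) :
    ContDiffOn ℝ ∞ (fun y ↦ emComplex g y μ ν) U := by
  unfold emComplex
  exact ContDiffOn.sum fun α _ ↦ contDiffOn_partialDeriv hU (contDiffOn_hField hU hg hdet μ ν α) α

/-- **The time derivative of `h^{μ0j}`**, identically: for spatial `j`,
`∂₀ h^{μ0j} = −Σ_α ∂_α h^{μjα} + Σ_{l=1}^{3} ∂_l h^{μjl}`
(`h^{μ0j} = −h^{μj0}` by (96.4), and the `α = 0` term of the complex). In vacuum the complex is
`(−g) t^{μj}_LL`, which turns this into LL's `∂₀ h^{μ0j} = −(−g)t^{μj} + (spatial curl)`.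
[cite: LandauLifshitz1975, §96 (96.11)] -/
theorem partialDeriv_zero_hField (g : E4 → E4 →L[ℝ] E4 →L[ℝ] ℝ) (x : E4) (μ : Fin 4)
    (j : Fin 3) :
    partialDeriv 0 (fun z ↦ hField g z μ 0 j.succ) x =
      -emComplex g x μ j.succ +
        ∑ l : Fin 3, partialDeriv l.succ (fun z ↦ hField g z μ j.succ l.succ) x := by
  have hswap : (fun z ↦ hField g z μ 0 j.succ) = fun z ↦ -hField g z μ j.succ 0 :=
    funext fun z ↦ hField_swap g z μ j.succ 0
  have h1 : partialDeriv 0 (fun z ↦ hField g z μ 0 j.succ) x =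
      -partialDeriv 0 (fun z ↦ hField g z μ j.succ 0) x := by
    rw [partialDeriv, partialDeriv, hswap, fderiv_fun_neg]
    rfl
  rw [h1, emComplex, Fin.sum_univ_succ]
  ring

/-- **Clause (iv) of `LLBalanceLaw` — the Landau–Lifshitz balance law on a coordinate sphere.**
Let `g` be `C^∞` with `det (g_{μν}) ≠ 0` and `Ric(g) = 0` on an open `U ⊆ E4` containing the
sphere `{x⁰ = t, |y − ξ| = R}`. Then the quasi-local momentum
`P^μ(s) = ∮_{|y−ξ|=R} Σ_j h^{μ0j}(s, y) n_j dσ` is differentiable at `s = t` with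
`dP^μ/dt = −Φ^μ = −∮ Σ_j (−g) t^{μj}_LL n_j dσ`. Proof: differentiate under the integral sign
(the slices `{s} × S_R`, `|s − t|` small, stay in `U`, where `∂₀h` is continuous, hence bounded on
that compact slab); pointwise `∂₀ h^{μ0j} = −Σ_α ∂_α h^{μjα} + Σ_l ∂_l h^{μjl}`
(`partialDeriv_zero_hField`) with `Σ_α ∂_α h^{μjα} = (−g) t^{μj}` in vacuum (LL (96.7) with
`G = 0`); and the flux of the spatial curl `Σ_l ∂_l h^{μjl}` (antisymmetric in `(j, l)`) through
the closed sphere vanishes (`setIntegral_sphere_sum_fderiv_antisymm_eq_zero_of_contDiffOn`) — only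
the metric NEAR the sphere is used. LL §96, (96.11)–(96.16). [cite: LandauLifshitz1975, §96 (96.16)] -/
theorem hasDerivAt_quasiLocalMomentum (hU : IsOpen U) (hg : ContDiffOn ℝ ∞ g U)
    (hdet : ∀ x ∈ U, metricDet g x ≠ 0) (hric : ∀ x ∈ U, MetricCoord.ricAt g x = 0)
    {t R : ℝ} {ξ : E3} (hS : ∀ y ∈ sphere ξ R, E4.ofTimeSpace t y ∈ U) (μ : Fin 4) :
    HasDerivAt (fun s ↦ quasiLocalMomentum g s ξ R μ) (-momentumFlux g t ξ R μ) t := by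
  -- the integrands of `P` and of its time derivative
  set F : ℝ → E3 → ℝ := fun s y ↦
    ∑ j : Fin 3, hField g (E4.ofTimeSpace s y) μ 0 j.succ * (y - ξ) j / R with hF
  set F' : ℝ → E3 → ℝ := fun s y ↦
    ∑ j : Fin 3, partialDeriv 0 (fun z ↦ hField g z μ 0 j.succ) (E4.ofTimeSpace s y) *
      (y - ξ) j / R with hF'
  set σ : Measure E3 := (μHE[2] : Measure E3).restrict (sphere ξ R) with hσ
  haveI : IsFiniteMeasure σ :=
    ⟨by rw [hσ, Measure.restrict_apply_univ]; exact euclideanHausdorff_sphere_lt_top ξ R⟩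
  have hP : (fun s ↦ quasiLocalMomentum g s ξ R μ) = fun s ↦ ∫ y, F s y ∂σ := rfl
  -- regularity of the fields on `U`
  have hh : ∀ ν α, ContDiffOn ℝ ∞ (fun z ↦ hField g z μ ν α) U := fun ν α ↦
    contDiffOn_hField hU hg hdet μ ν α
  have hdh : ∀ β ν α, ContDiffOn ℝ ∞ (fun z ↦ partialDeriv β (fun w ↦ hField g w μ ν α) z) U :=
    fun β ν α ↦ contDiffOn_partialDeriv hU (hh ν α) β
  have hhd : ∀ ν α, ∀ z ∈ U, DifferentiableAt ℝ (fun w ↦ hField g w μ ν α) z := fun ν α z hz ↦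
    ((hh ν α).differentiableOn (by simp)).differentiableAt (hU.mem_nhds hz)
  have hcoord : ∀ j : Fin 3, Continuous fun y : E3 ↦ (y - ξ) j := fun j ↦
    (PiLp.continuous_apply 2 _ j).comp (continuous_id.sub continuous_const)
  -- Step 1: a slab `{|s - t| < δ} × S_R ⊆ U`
  obtain ⟨δ, hδ, hslab⟩ := exists_slab_subset hU (isCompact_sphere ξ R) hS
  have hδ2 : 0 < δ / 2 := by positivity
  have hδ4 : 0 < δ / 4 := by positivity
  have hball : ∀ s ∈ ball t (δ / 2), ∀ y ∈ sphere ξ R, E4.ofTimeSpace s y ∈ U := fun s hs y hy ↦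
    hslab s (lt_of_lt_of_le (mem_ball.1 hs) (by linarith)) y hy
  have htin : t ∈ ball t (δ / 2) := mem_ball_self hδ2
  -- a continuous field on `U`, evaluated on a slice in the slab and multiplied by `n_j`, is
  -- continuous on the sphere
  have hcomp : ∀ {G : E4 → ℝ}, ContinuousOn G U → ∀ s ∈ ball t (δ / 2), ∀ j : Fin 3,
      ContinuousOn (fun y ↦ G (E4.ofTimeSpace s y) * (y - ξ) j / R) (sphere ξ R) := by
    intro G hG s hs j
    exact (((continuousOn_comp_ofTimeSpace hG s).mono fun y hy ↦ hball s hs y hy).mul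
      (hcoord j).continuousOn).div_const _
  have hFc : ∀ s ∈ ball t (δ / 2), ContinuousOn (F s) (sphere ξ R) := fun s hs ↦
    continuousOn_finsetSum _ fun j _ ↦ hcomp (hh 0 j.succ).continuousOn s hs j
  have hF'c : ContinuousOn (F' t) (sphere ξ R) :=
    continuousOn_finsetSum _ fun j _ ↦ hcomp (hdh 0 0 j.succ).continuousOn t htin j
  -- Step 2: a uniform bound for `F'` on the compact slab `closedBall t (δ/4) × S_R`
  have hK2 : IsCompact (closedBall t (δ / 4) ×ˢ sphere ξ R) :=
    (isCompact_closedBall _ _).prod (isCompact_sphere _ _)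
  have hΦc : ContinuousOn (fun p : ℝ × E3 ↦ F' p.1 p.2) (closedBall t (δ / 4) ×ˢ sphere ξ R) := by
    refine continuousOn_finsetSum _ fun j _ ↦ ContinuousOn.div_const (ContinuousOn.mul ?_ ?_) _
    · refine (hdh 0 0 j.succ).continuousOn.comp E4.continuous_ofTimeSpace_uncurry.continuousOn ?_
      rintro ⟨s, y⟩ ⟨hs, hy⟩
      exact hball s (closedBall_subset_ball (by linarith) hs) y hy
    · exact ((hcoord j).comp continuous_snd).continuousOn
  obtain ⟨M, hM⟩ := hK2.exists_bound_of_continuousOn hΦc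
  -- Step 3: differentiate under the integral sign
  have hderiv : HasDerivAt (fun s ↦ ∫ y, F s y ∂σ) (∫ y, F' t y ∂σ) t := by
    refine (hasDerivAt_integral_of_dominated_loc_of_deriv_le (μ := σ) (x₀ := t) (F := F)
      (F' := F') (s := ball t (δ / 4)) (bound := fun _ ↦ M) (ball_mem_nhds t hδ4) ?_ ?_ ?_ ?_
      (integrable_const M) ?_).2
    · filter_upwards [ball_mem_nhds t hδ2] with s hs
      exact (hFc s hs).aestronglyMeasurable isClosed_sphere.measurableSet
    · exact integrableOn_sphere_of_continuousOn (hFc t htin)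
    · exact hF'c.aestronglyMeasurable isClosed_sphere.measurableSet
    · refine (ae_restrict_iff' isClosed_sphere.measurableSet).2 (ae_of_all _ fun y hy s hs ↦ ?_)
      exact hM (s, y) ⟨ball_subset_closedBall hs, hy⟩
    · refine (ae_restrict_iff' isClosed_sphere.measurableSet).2 (ae_of_all _ fun y hy s hs ↦ ?_)
      have hsU : E4.ofTimeSpace s y ∈ U := hball s (ball_subset_ball (by linarith) hs) y hy
      have hterm : ∀ j : Fin 3, HasDerivAt
          (fun s ↦ hField g (E4.ofTimeSpace s y) μ 0 j.succ * (y - ξ) j / R)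
          (partialDeriv 0 (fun z ↦ hField g z μ 0 j.succ) (E4.ofTimeSpace s y) * (y - ξ) j / R)
          s := by
        intro j
        have h := (hhd 0 j.succ _ hsU).hasFDerivAt.comp_hasDerivAt s
          (E4.hasDerivAt_ofTimeSpace_left s y)
        exact (h.mul_const ((y - ξ) j)).div_const R
      exact HasDerivAt.fun_sum fun j _ ↦ hterm j
  -- Step 4: evaluate the derivative at `s = t`
  have hval : ∫ y, F' t y ∂σ = -momentumFlux g t ξ R μ := by
    set Φ : E3 → ℝ := fun y ↦
      ∑ j : Fin 3, emComplex g (E4.ofTimeSpace t y) μ j.succ * (y - ξ) j / R with hΦ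
    set Ψ : E3 → ℝ := fun y ↦ ∑ j : Fin 3, ∑ l : Fin 3,
      partialDeriv l.succ (fun z ↦ hField g z μ j.succ l.succ) (E4.ofTimeSpace t y) *
        (y - ξ) j / R with hΨ
    -- pointwise on the sphere: `F' t = -Φ + Ψ`
    have hpt : ∀ y ∈ sphere ξ R, F' t y = -Φ y + Ψ y := by
      intro y _
      simp only [hF', hΦ, hΨ]
      rw [← Finset.sum_neg_distrib, ← Finset.sum_add_distrib]
      refine Finset.sum_congr rfl fun j _ ↦ ?_
      rw [partialDeriv_zero_hField g (E4.ofTimeSpace t y) μ j, add_mul, add_div, neg_mul, neg_div,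
        Finset.sum_mul, Finset.sum_div]
    have hΦc' : ContinuousOn Φ (sphere ξ R) := continuousOn_finsetSum _ fun j _ ↦
      hcomp (contDiffOn_emComplex hU hg hdet μ j.succ).continuousOn t htin j
    have hΨc : ContinuousOn Ψ (sphere ξ R) := continuousOn_finsetSum _ fun j _ ↦
      continuousOn_finsetSum _ fun l _ ↦ hcomp (hdh l.succ j.succ l.succ).continuousOn t htin j
    have hΦi : Integrable Φ σ := integrableOn_sphere_of_continuousOn hΦc'
    have hΨi : Integrable Ψ σ := integrableOn_sphere_of_continuousOn hΨc
    -- the flux: in vacuum `(−g) t^{μj} = Σ_α ∂_α h^{μjα}` on the sphere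
    have hflux : momentumFlux g t ξ R μ = ∫ y, Φ y ∂σ := by
      rw [momentumFlux]
      refine setIntegral_congr_fun isClosed_sphere.measurableSet fun y hy ↦ ?_
      refine Finset.sum_congr rfl fun j _ ↦ ?_
      rw [emComplex_eq_neg_metricDet_mul (hdet _ (hS y hy)),
        einsteinUpper_eq_zero_of_ricAt_eq_zero (hric _ (hS y hy)), mul_zero, zero_add]
    -- the curl term integrates to zero over the closed sphere
    have hcurl : ∫ y, Ψ y ∂σ = 0 := by
      set A : Fin 3 → Fin 3 → E3 → ℝ := fun j l y ↦
        hField g (E4.ofTimeSpace t y) μ j.succ l.succ with hA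
      have hV : IsOpen (E4.ofTimeSpace t ⁻¹' U) := hU.preimage (E4.continuous_ofTimeSpace t)
      have hAV : ∀ j l, ContDiffOn ℝ 1 (A j l) (E4.ofTimeSpace t ⁻¹' U) := fun j l ↦
        ((hh j.succ l.succ).comp (E4.contDiff_ofTimeSpace t).contDiffOn (mapsTo_preimage _ _)).of_le
          (by simp)
      have hAanti : ∀ j l y, A l j y = -A j l y := fun j l y ↦ hField_swap g _ μ j.succ l.succ
      have hSV : sphere ξ R ⊆ E4.ofTimeSpace t ⁻¹' U := fun y hy ↦ hS y hy
      have h0 := setIntegral_sphere_sum_fderiv_antisymm_eq_zero_of_contDiffOn hV hAV hAanti hSV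
      -- chain rule along the slice: `∂_{l+1} h (t, y) = D(A^{jl})(y) e_l`
      have hchain : ∀ y ∈ sphere ξ R, ∀ j l : Fin 3,
          partialDeriv l.succ (fun z ↦ hField g z μ j.succ l.succ) (E4.ofTimeSpace t y) =
            fderiv ℝ (A j l) y (EuclideanSpace.single l 1) := by
        intro y hy j l
        have h' : HasFDerivAt (A j l) ((fderiv ℝ (fun w ↦ hField g w μ j.succ l.succ)
            (E4.ofTimeSpace t y)).comp E4.spaceEmbed) y :=
          (hhd j.succ l.succ _ (hS y hy)).hasFDerivAt.comp y (E4.hasFDerivAt_ofTimeSpace t y)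
        rw [h'.fderiv, ContinuousLinearMap.comp_apply, spaceEmbed_single, partialDeriv]
      have hΨeq : ∫ y, Ψ y ∂σ = (∫ y in sphere ξ R, ∑ j, ∑ l,
          fderiv ℝ (A j l) y (EuclideanSpace.single l 1) * (y - ξ) j ∂(μHE[2] : Measure E3)) / R := by
        rw [← integral_div]
        refine setIntegral_congr_fun isClosed_sphere.measurableSet fun y hy ↦ ?_
        simp only [hΨ, Finset.sum_div]
        refine Finset.sum_congr rfl fun j _ ↦ Finset.sum_congr rfl fun l _ ↦ ?_
        rw [hchain y hy j l]
      rw [hΨeq, h0, zero_div]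
    calc ∫ y, F' t y ∂σ = ∫ y, (-Φ y + Ψ y) ∂σ :=
          setIntegral_congr_fun isClosed_sphere.measurableSet hpt
      _ = -∫ y, Φ y ∂σ + ∫ y, Ψ y ∂σ := by
          rw [← integral_neg]
          exact integral_add hΦi.neg hΨi
      _ = -momentumFlux g t ξ R μ := by rw [hcurl, add_zero, hflux]
  rw [hP, ← hval]
  exact hderiv

end Momentum

end LLBalance

end Summit.FinalStateConjecture.FinalStateConjecture.Theorems

end
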